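import Summits.Parity.GeneralizedHardyLittlewood.Theorems.LeeYangFibresRelativeDimOneMoebiusSplitStubDefs
import Literature.NumberTheory.Sieve.LinearEquationsInPrimesSieveDensities
import Literature.NumberTheory.Sieve.LinearEquationsInPrimesDimOne
import Mathlib
import HarnessLib

/-!
# Route `LeeYangFibres`, crux `RelativeDimOne` (stmt-Parity-14113), line `single-moebius-split`,
# stub `stub_tssLocalData` (T1b-B): the local data of a `d = 1` system

For a system `Ψ = (ψ_i)_{i < t}` of affine-linear forms in ONE variable and a tuple `d` of
square-free positive integers below `y`, the normalised solution count of the divisibility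
system `d_i ∣ ψ_i(n)` (`n mod ∏ d_i`) factors prime by prime:
`ρ_Ψ(d) / ∏_i d_i = ∏_{p < y} g^Ψ_p({i : p ∣ d_i})`, `g^Ψ_p(S) = #{r mod p : p ∣ ψ_i(r) ∀ i ∈ S}/p`
(`TSSLocalData t`). The proof runs through the tree's local densities (Green–Tao 2010, App. D):

* `tssL_expect_eq_sum_range` — an average over `ℤ_M^1` is a normalised sum over `{0, …, M − 1}`;
* `tssL_localDensity_eq_solCount` — `α_d(Ψ) = ρ_Ψ(d)/∏ d_i` (`localDensity` versus `solCount`);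
* `tssL_primeDensity_eq_gyWeight` — `α(p, S) = g^Ψ_p(S)` (`primeDensity` versus
  `gyWeight`/`rootSet`);
* `tssL_localDensity_prod` — multiplicativity over a finite set of primes (`localDensity_mul`,
  `localDensity_primeModuli`), for moduli `m_i = ∏_{p ∈ T} (p if i ∈ S_p else 1)`;
* `tssL_eq_prod_primeModuli` — a square-free `d_i` is the product of the primes `p ∣ ∏ d_j`
  dividing it;
* `stub_tssLocalData` — assembly (primes `p < y` dividing no `d_i` contribute `g_p(∅) = 1`).
-/

noncomputable section

open scoped BigOperators Classical
open Finset Literature.NumberTheory.Sieve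

namespace Summit.Parity.GeneralizedHardyLittlewood.Cruxes.RelativeDimOne.SingleMoebiusSplit

variable {t : ℕ}

/-! ### Averages over `ℤ_M^1` -/

/-- An average over `ℤ_M^1 = (Fin 1 → ZMod M)` is the sum over the representatives `0 ≤ n < M`
divided by `M`. -/
theorem tssL_expect_eq_sum_range {M : ℕ} [NeZero M] (F : (Fin 1 → ZMod M) → ℝ) :
    𝔼 r, F r = (∑ n ∈ Finset.range M, F (fun _ => (n : ZMod M))) / M := by
  rw [Fintype.expect_eq_sum_div_card, card_zmod_pow, pow_one]
  congr 1
  refine Finset.sum_nbij' (fun r => (r 0).val) (fun n _ => (n : ZMod M)) (fun r _ => ?_)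
    (fun _ _ => Finset.mem_univ _) (fun r _ => ?_) (fun n hn => ?_) (fun r _ => ?_)
  · exact Finset.mem_range.mpr (ZMod.val_lt (r 0))
  · funext j
    rw [Fin.fin_one_eq_zero j, ZMod.natCast_zmod_val]
  · exact ZMod.val_natCast_of_lt (Finset.mem_range.mp hn)
  · congr 1
    funext j
    rw [Fin.fin_one_eq_zero j, ZMod.natCast_zmod_val]

/-! ### `localDensity` versus `solCount` -/

/-- `α_d(Ψ) = ρ_Ψ(d) / ∏_i d_i`: the local density of the divisibility system `d_i ∣ ψ_i` is the
normalised count of its solutions `n mod ∏ d_i`. -/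
theorem tssL_localDensity_eq_solCount (Ψ : Fin t → AffLinForm 1) (d : Fin t → ℕ)
    [NeZero (∏ i, d i)] :
    localDensity Ψ d = (solCount Ψ d : ℝ) / ((∏ i, d i : ℕ) : ℝ) := by
  unfold localDensity
  rw [tssL_expect_eq_sum_range]
  congr 1
  unfold solCount
  rw [Finset.natCast_card_filter]
  refine Finset.sum_congr rfl fun n _ => ?_
  have h := divWeight_intCast Ψ d (fun _ => (n : ℤ))
  simp only [Int.cast_natCast] at h
  rw [h, Finset.prod_ite_zero, Finset.prod_const_one]
  by_cases hP : ∀ i, ((d i : ℕ) : ℤ) ∣ (Ψ i).eval (fun _ => (n : ℤ))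
  · rw [if_pos hP, if_pos fun i _ => hP i]
  · rw [if_neg hP, if_neg fun h' => hP fun i => h' i (Finset.mem_univ i)]

/-! ### `primeDensity` versus the root data `gyWeight`/`rootSet` -/

/-- `α(p, S) = g^Ψ_p(S) = #{r mod p : p ∣ ψ_i(r) for all i ∈ S}/p`. -/
theorem tssL_primeDensity_eq_gyWeight (Ψ : Fin t → AffLinForm 1) (S : Finset (Fin t)) (p : ℕ)
    [NeZero p] : primeDensity Ψ S p = gyWeight (fun q => Finset.range q) (rootSet Ψ) p S := by
  unfold primeDensity gyWeight
  rw [tssL_expect_eq_sum_range]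
  congr 1
  rw [Finset.natCast_card_filter]
  refine Finset.sum_congr rfl fun n hn => ?_
  rw [Finset.prod_ite_zero, Finset.prod_const_one]
  have hiff : ∀ i ∈ S, ((Ψ i).modEval p (fun _ => ((n : ℕ) : ZMod p)) = 0 ↔ n ∈ rootSet Ψ p i) := by
    intro i _
    have h := AffLinForm.intCast_eval (Ψ i) p (fun _ => (n : ℤ))
    simp only [Int.cast_natCast] at h
    rw [← h, ZMod.intCast_zmod_eq_zero_iff_dvd, rootSet, Finset.mem_filter]
    exact ⟨fun h' => ⟨hn, h'⟩, fun h' => h'.2⟩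
  by_cases hP : ∀ i ∈ S, n ∈ rootSet Ψ p i
  · rw [if_pos hP, if_pos fun i hi => (hiff i hi).mpr (hP i hi)]
  · rw [if_neg hP, if_neg fun h' => hP fun i hi => (hiff i hi).mp (h' i hi)]

/-- `α_{(p on S, 1 off S)}(Ψ) = g^Ψ_p(S)` for a prime (indeed any positive) `p`. -/
theorem tssL_localDensity_primeModuli (Ψ : Fin t → AffLinForm 1) (S : Finset (Fin t)) (p : ℕ)
    [NeZero p] [NeZero (∏ i, primeModuli S p i)] :
    localDensity Ψ (primeModuli S p) = gyWeight (fun q => Finset.range q) (rootSet Ψ) p S := by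
  rw [localDensity_primeModuli, tssL_primeDensity_eq_gyWeight]

/-! ### Multiplicativity over a finite set of primes -/

/-- The prime-patterned moduli are positive. -/
theorem tssL_prod_primeModuli_pos (S : ℕ → Finset (Fin t)) (T : Finset ℕ)
    (hT : ∀ p ∈ T, p.Prime) (i : Fin t) : 0 < ∏ p ∈ T, primeModuli (S p) p i :=
  Finset.prod_pos fun p hp => by
    unfold primeModuli
    split_ifs
    · exact (hT p hp).pos
    · exact one_pos

/-- **Multiplicativity** (Chinese remainder theorem, `localDensity_mul`): for a finite set `T` of
primes and index sets `S_p`, the local density at the moduli `m_i = ∏_{p ∈ T, i ∈ S_p} p` is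
`∏_{p ∈ T} g^Ψ_p(S_p)`. -/
theorem tssL_localDensity_prod (Ψ : Fin t → AffLinForm 1) (S : ℕ → Finset (Fin t)) :
    ∀ T : Finset ℕ, (∀ p ∈ T, p.Prime) → ∀ (m : Fin t → ℕ) [NeZero (∏ i, m i)],
      (∀ i, m i = ∏ p ∈ T, primeModuli (S p) p i) →
        localDensity Ψ m = ∏ p ∈ T, gyWeight (fun q => Finset.range q) (rootSet Ψ) p (S p) := by
  intro T
  induction T using Finset.induction_on with
  | empty =>
    intro _ m _ hm
    have hfun : m = primeModuli (∅ : Finset (Fin t)) 1 := funext fun i => by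
      rw [hm i, Finset.prod_empty]
      simp [primeModuli]
    subst hfun
    rw [Finset.prod_empty, localDensity_primeModuli, primeDensity_empty]
  | insert a T haT ih =>
    intro hprime m _ hm
    have ha : a.Prime := hprime a (Finset.mem_insert_self a T)
    have hT : ∀ p ∈ T, p.Prime := fun p hp => hprime p (Finset.mem_insert_of_mem hp)
    haveI : NeZero a := ⟨ha.ne_zero⟩
    haveI : NeZero (∏ i, primeModuli (S a) a i) :=
      ⟨by rw [prod_primeModuli]; exact pow_ne_zero _ ha.ne_zero⟩
    haveI : NeZero (∏ i, ∏ p ∈ T, primeModuli (S p) p i) :=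
      ⟨(Finset.prod_pos fun i _ => tssL_prod_primeModuli_pos S T hT i).ne'⟩
    have hfun : m = fun i => primeModuli (S a) a i * ∏ p ∈ T, primeModuli (S p) p i :=
      funext fun i => (hm i).trans (Finset.prod_insert haT)
    subst hfun
    have hcop : Nat.Coprime (∏ i, primeModuli (S a) a i)
        (∏ i, ∏ p ∈ T, primeModuli (S p) p i) := by
      rw [prod_primeModuli]
      refine Nat.Coprime.pow_left _
        (Nat.Coprime.prod_right fun i _ => Nat.Coprime.prod_right fun p hp => ?_)
      unfold primeModuli
      split_ifs
      · exact (Nat.coprime_primes ha (hT p hp)).mpr (ne_of_mem_of_not_mem hp haT).symm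
      · exact Nat.coprime_one_right a
    rw [localDensity_mul Ψ (primeModuli (S a) a) (fun i => ∏ p ∈ T, primeModuli (S p) p i) hcop,
      Finset.prod_insert haT, ih hT (fun i => ∏ p ∈ T, primeModuli (S p) p i) (fun _ => rfl),
      tssL_localDensity_primeModuli]

/-! ### Square-free moduli, prime by prime -/

/-- A square-free `d_i` is the product, over the primes `p` of `∏_j d_j`, of `p` if `p ∣ d_i` and
`1` otherwise. -/
theorem tssL_eq_prod_primeModuli {d : Fin t → ℕ} (hpos : ∀ i, 0 < d i)
    (hsq : ∀ i, Squarefree (d i)) (i : Fin t) :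
    d i = ∏ p ∈ (∏ j, d j).primeFactors,
      primeModuli (Finset.univ.filter fun j => p ∣ d j) p i := by
  have hM : (∏ j, d j) ≠ 0 := (Finset.prod_pos fun j _ => hpos j).ne'
  have hdvd : d i ∣ ∏ j, d j := Finset.dvd_prod_of_mem d (Finset.mem_univ i)
  have h1 : ∀ p : ℕ, primeModuli (Finset.univ.filter fun j => p ∣ d j) p i =
      if p ∣ d i then p else 1 := fun p => by
    unfold primeModuli
    exact if_congr (by simp) rfl rfl
  simp_rw [h1]
  rw [← Finset.prod_filter]
  have h2 : (∏ j, d j).primeFactors.filter (fun p => p ∣ d i) = (d i).primeFactors := by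
    ext p
    simp only [Finset.mem_filter, Nat.mem_primeFactors]
    exact ⟨fun h => ⟨h.1.1, h.2, (hpos i).ne'⟩, fun h => ⟨⟨h.1, h.2.1.trans hdvd, hM⟩, h.2.1⟩⟩
  rw [h2]
  exact (Nat.prod_primeFactors_of_squarefree (hsq i)).symm

/-! ### Assembly -/

/-- **T1b-B — the local data of a `d = 1` system.** For square-free positive `d_i < y`,
`ρ_Ψ(d)/∏_i d_i = ∏_{p<y} g^Ψ_p({i : p ∣ d_i})` with `g^Ψ_p(S) = #{r mod p : p ∣ ψ_i(r) ∀ i ∈ S}/p`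
(Chinese remainder theorem via `localDensity_mul`; primes dividing no `d_i` contribute
`g_p(∅) = 1`). -/
theorem stub_tssLocalData : ∀ t : ℕ, TSSLocalData t := by
  intro t Ψ d y hpos hsq hlt
  have hM : 0 < ∏ i, d i := Finset.prod_pos fun i _ => hpos i
  haveI : NeZero (∏ i, d i) := ⟨hM.ne'⟩
  have hcast : (∏ i, (d i : ℝ)) = ((∏ i, d i : ℕ) : ℝ) := by push_cast; rfl
  rw [hcast, ← tssL_localDensity_eq_solCount,
    tssL_localDensity_prod Ψ (fun p => Finset.univ.filter fun i => p ∣ d i) (∏ i, d i).primeFactors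
      (fun p hp => Nat.prime_of_mem_primeFactors hp) d (tssL_eq_prod_primeModuli hpos hsq)]
  refine Finset.prod_subset (fun p hp => ?_) (fun p hp hpT => ?_)
  · obtain ⟨hpr, hpd, -⟩ := Nat.mem_primeFactors.mp hp
    obtain ⟨i, -, hi⟩ := (hpr.prime.dvd_finsetProd_iff _).mp hpd
    exact Nat.mem_primesBelow.mpr ⟨(Nat.le_of_dvd (hpos i) hi).trans_lt (hlt i), hpr⟩
  · have hpr : p.Prime := (Nat.mem_primesBelow.mp hp).2
    have hS : ∀ i ∈ (Finset.univ : Finset (Fin t)), ¬ p ∣ d i := fun i _ hpd =>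
      hpT (Nat.mem_primeFactors.mpr
        ⟨hpr, hpd.trans (Finset.dvd_prod_of_mem d (Finset.mem_univ i)), hM.ne'⟩)
    show gyWeight _ _ p (Finset.univ.filter fun i => p ∣ d i) = 1
    rw [Finset.filter_false_of_mem hS]
    exact gyWeight_empty_of_range _ hpr.pos

end Summit.Parity.GeneralizedHardyLittlewood.Cruxes.RelativeDimOne.SingleMoebiusSplit
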